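import Summits.ResolutionOfSingularities.ResolutionOfSingularities.Theorems.FrobeniusLadderFInjectiveMacaulayficationTauFloorBMonicTower
import Summits.ResolutionOfSingularities.ResolutionOfSingularities.Theorems.FrobeniusLadderFInjectiveMacaulayficationTauFloorBXChartIdent
import Summits.ResolutionOfSingularities.ResolutionOfSingularities.Theorems.FrobeniusLadderFInjectiveMacaulayficationTauFloorF5YChartIdent
import Literature.AlgebraicGeometry.Resolution.AffineBlowupAlgebra
import HarnessLib

/-!
# (N2-Y″) The tower `T₂(X1², 1+X2³) = k[y, x′, u′, w][t][z′]` IS the Rees chart `D(ȳ)` of `Bl_τ(P2d4B)`: `T₂ ≃+* A₀[τ/ȳ] = blowupAlgebra τ ȳ`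
# (crux `FInjectiveMacaulayfication` stmt-ResolutionOfSingularities-15315, chain w45a; res-L1-w45a-plan-1 g19 RULING R19.6 (3) «(N2) ROW #3 INPUT LEGALITY → stub-2»,
# legal side, chart `D(ȳ)`; the `D(x̄)` twin is `…TauFloorBXChartIdent` (p635410), same method; seat res-L1-w45a-stub-2 g8)

[OURS · L1 W4.5a] Support file (`--supports stmt-ResolutionOfSingularities-15315 --as helper`); replaces the role of NO printed item; NOT a statement of
any manuscript; def-free; UNCONDITIONAL; characteristic-free (any field `k`). AI-written (AI review is weaker than expert review).

`A₀ = k[X0..X4]/(f)`, `f = X4² + X0²X4 + X1³ + X2³ + X3⁵` (P2d4B), `τ = Ideal.span {x̄, ȳ, ū, t̄², z̄}`. On `D(ȳ)`: `x = yx′`, `u = yu′`, `z = yz′`, `t² = yw`,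
`f = y²·(z′² + yx′²z′ + y(1+u′³) + tw²)`, i.e. the generic tower `T₂(c, d)` of `…TauFloorBMonicTower` (base `B₀ = k[X0..X3]`, `X0 = y`, `X1 = x′`, `X2 = u′`, `X3 = w`)
at `(c, d) = (X1², 1 + X2³)`.
* §1 ring identities, `f_rel_away`, ★ `exists_chartMap` (`φ : T₂ → A₀[1/ȳ]`, `y, x′, u′, w, t, z′ ↦ ȳ, x̄/ȳ, ū/ȳ, t̄²/ȳ, t̄, z̄/ȳ` — ONE application of the universal
  property `TauFloorBMonicTower.exists_towerLift`), ★ `exists_blowdownMap` (`ψ₁ : A₀ → T₂`, `x̄, ȳ, ū, t̄, z̄ ↦ yx′, y, yu′, t, yz′`);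
* §2 ★ `chartMap_injective` (`y = X0` is a NON-ZERO-DIVISOR of `T₂`: `TauFloorBMonicTower.algebraMap_X0_mem_nonZeroDivisors`);
* §3 ★★ `exists_chartEquiv : ∃ e : T₂ ≃+* blowupAlgebra τ ȳ` with the generator values (`TauFloorF5YChartIdent.adjoinRoot_subring_eq_top` BY NAME; `Algebra.adjoin_le`).
Hence (next file) CM at every prime of `A₀[τ/ȳ]` (`TauFloorBMonicTower.cmCl_localization`), and of `A₀[τ/ū]` by the symmetry `X1 ↔ X2`.
[cite: GortzWedhorn2020, (13.19) p. 415] [cite: StacksProject, Tag 0804]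
-/

-- single-problem summit: the doubled namespace component is forced
set_option linter.dupNamespace false
-- `Localization.Away (Ideal.Quotient.mk (Ideal.span {f}) (X 1))`: instance search through the Ore-localization `DistribMulAction A₀ A₀` goal is SLOW for
-- this spelling of the chart element (it succeeds; the default 20000 is not enough — measured on `f_rel_away` alone); the spelling is kept because it is the
-- one the row files (p630078/p630677) and `LocalBlowupInputFromCharts` use for the generator `x̄` of `τ`.
set_option synthInstance.maxHeartbeats 400000

noncomputable section

namespace Summit.ResolutionOfSingularities.ResolutionOfSingularities.Theorems.FInjectiveMacaulayfication.TauFloorBYChartIdent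

open MvPolynomial IsLocalization Literature.AlgebraicGeometry.Resolution
open Summit.ResolutionOfSingularities.ResolutionOfSingularities.Theorems.FInjectiveMacaulayfication
open TauFloorBXChartAlgebra TauFloorBMonicTower

variable (k : Type) [Field k]

/-! ## §1 The chart map `φ : T₂ → A₀[1/x̄]` and the blow-down map `ψ₁ : A₀ → T₂` -/

/-- `h₂(z·i) = 0` in `A₀[1/ȳ]`: `(zi)² + y(xi)²(zi) + (y(1 + (ui)³) + T(T²i)²) = 0` when `z² + x²z + y³ + u³ + T⁵ = 0` and `y·i = 1`. [ring identity] -/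
theorem ident_z_y {L : Type} [CommRing L] (x y u T z i : L) (hF : z ^ 2 + x ^ 2 * z + y ^ 3 + u ^ 3 + T ^ 5 = 0) (hyi : y * i = 1) :
    (z * i) ^ 2 + y * (x * i) ^ 2 * (z * i) + (y * (1 + (u * i) ^ 3) + T * (T ^ 2 * i) ^ 2) = 0 := by
  linear_combination (i ^ 2) * hF + (x ^ 2 * z * i ^ 2 - y * (1 + y * i) + u ^ 3 * i ^ 2) * hyi

/-- `f(yx′, y, yu′, t, yz′) = y²·(z′² + yx′²z′ + y(1+u′³) + tw²)` modulo `t² = yw`. [ring identity] -/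
theorem ident_blowdown_y {T : Type} [CommRing T] (y x u w t z : T) (ht : t ^ 2 = y * w)
    (hz : z ^ 2 = -(y * x ^ 2 * z + y * (1 + u ^ 3) + t * w ^ 2)) :
    (y * z) ^ 2 + (y * x) ^ 2 * (y * z) + y ^ 3 + (y * u) ^ 3 + t ^ 5 = 0 := by
  linear_combination (y ^ 2) * hz + (t * (t ^ 2 + y * w)) * ht

/-- `f̄ = 0` read in `A₀[1/ȳ]`, expanded. [plumbing] -/
theorem f_rel_away (f : MvPolynomial (Fin 5) k) (hf : f = X 4 ^ 2 + X 0 ^ 2 * X 4 + X 1 ^ 3 + X 2 ^ 3 + X 3 ^ 5) :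
    algebraMap (MvPolynomial (Fin 5) k ⧸ Ideal.span {f}) (Localization.Away (Ideal.Quotient.mk (Ideal.span {f}) (X 1) : MvPolynomial (Fin 5) k ⧸ Ideal.span {f})) (Ideal.Quotient.mk (Ideal.span {f}) (X 4)) ^ 2 +
      algebraMap (MvPolynomial (Fin 5) k ⧸ Ideal.span {f}) (Localization.Away (Ideal.Quotient.mk (Ideal.span {f}) (X 1) : MvPolynomial (Fin 5) k ⧸ Ideal.span {f})) (Ideal.Quotient.mk (Ideal.span {f}) (X 0)) ^ 2 *
        algebraMap (MvPolynomial (Fin 5) k ⧸ Ideal.span {f}) (Localization.Away (Ideal.Quotient.mk (Ideal.span {f}) (X 1) : MvPolynomial (Fin 5) k ⧸ Ideal.span {f})) (Ideal.Quotient.mk (Ideal.span {f}) (X 4)) +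
      algebraMap (MvPolynomial (Fin 5) k ⧸ Ideal.span {f}) (Localization.Away (Ideal.Quotient.mk (Ideal.span {f}) (X 1) : MvPolynomial (Fin 5) k ⧸ Ideal.span {f})) (Ideal.Quotient.mk (Ideal.span {f}) (X 1)) ^ 3 +
      algebraMap (MvPolynomial (Fin 5) k ⧸ Ideal.span {f}) (Localization.Away (Ideal.Quotient.mk (Ideal.span {f}) (X 1) : MvPolynomial (Fin 5) k ⧸ Ideal.span {f})) (Ideal.Quotient.mk (Ideal.span {f}) (X 2)) ^ 3 +
      algebraMap (MvPolynomial (Fin 5) k ⧸ Ideal.span {f}) (Localization.Away (Ideal.Quotient.mk (Ideal.span {f}) (X 1) : MvPolynomial (Fin 5) k ⧸ Ideal.span {f})) (Ideal.Quotient.mk (Ideal.span {f}) (X 3)) ^ 5 = 0 := by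
  have h0 : Ideal.Quotient.mk (Ideal.span {f}) (X 4 ^ 2 + X 0 ^ 2 * X 4 + X 1 ^ 3 + X 2 ^ 3 + X 3 ^ 5 : MvPolynomial (Fin 5) k) = 0 := by
    rw [← hf]; exact Ideal.Quotient.eq_zero_iff_mem.mpr (Ideal.mem_span_singleton_self f)
  have h1 := congrArg (algebraMap (MvPolynomial (Fin 5) k ⧸ Ideal.span {f}) (Localization.Away (Ideal.Quotient.mk (Ideal.span {f}) (X 1) : MvPolynomial (Fin 5) k ⧸ Ideal.span {f}))) h0
  rw [map_zero] at h1
  simpa only [map_add, map_mul, map_pow] using h1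

/-- ★ **THE CHART MAP `φ : T₂ → A₀[1/ȳ]`** (`y, x′, u′, w ↦ ȳ, x̄/ȳ, ū/ȳ, t̄²/ȳ`, `t ↦ t̄`, `z′ ↦ z̄/ȳ`) exists — by the universal property of the tower.
[cite: GortzWedhorn2020, (13.19) p. 415] -/
theorem exists_chartMap (f : MvPolynomial (Fin 5) k) (hf : f = X 4 ^ 2 + X 0 ^ 2 * X 4 + X 1 ^ 3 + X 2 ^ 3 + X 3 ^ 5)
    (h₁ : Polynomial (MvPolynomial (Fin 4) k)) (hh₁ : h₁ = Polynomial.X ^ 2 - Polynomial.C (X 0 * X 3))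
    (h₂ : Polynomial (AdjoinRoot h₁))
    (hh₂ : h₂ = Polynomial.X ^ 2 + (Polynomial.C (algebraMap (MvPolynomial (Fin 4) k) (AdjoinRoot h₁) (X 0 * X 1 ^ 2)) * Polynomial.X +
      Polynomial.C (algebraMap (MvPolynomial (Fin 4) k) (AdjoinRoot h₁) (X 0 * (1 + X 2 ^ 3)) +
        AdjoinRoot.root h₁ * algebraMap (MvPolynomial (Fin 4) k) (AdjoinRoot h₁) (X 3 ^ 2)))) :
    ∃ φ : AdjoinRoot h₂ →+* Localization.Away (Ideal.Quotient.mk (Ideal.span {f}) (X 1) : MvPolynomial (Fin 5) k ⧸ Ideal.span {f}),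
      (∀ a : k, φ (algebraMap (MvPolynomial (Fin 4) k) (AdjoinRoot h₂) (C a)) = algebraMap (MvPolynomial (Fin 5) k ⧸ Ideal.span {f}) _ (Ideal.Quotient.mk (Ideal.span {f}) (C a))) ∧
      (∀ i : Fin 4, φ (algebraMap (MvPolynomial (Fin 4) k) (AdjoinRoot h₂) (X i)) =
        ![algebraMap (MvPolynomial (Fin 5) k ⧸ Ideal.span {f}) _ (Ideal.Quotient.mk (Ideal.span {f}) (X 1)), algebraMap (MvPolynomial (Fin 5) k ⧸ Ideal.span {f}) _ (Ideal.Quotient.mk (Ideal.span {f}) (X 0)) * Away.invSelf (Ideal.Quotient.mk (Ideal.span {f}) (X 1)), algebraMap (MvPolynomial (Fin 5) k ⧸ Ideal.span {f}) _ (Ideal.Quotient.mk (Ideal.span {f}) (X 2)) * Away.invSelf (Ideal.Quotient.mk (Ideal.span {f}) (X 1)),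
          algebraMap (MvPolynomial (Fin 5) k ⧸ Ideal.span {f}) _ (Ideal.Quotient.mk (Ideal.span {f}) (X 3)) ^ 2 * Away.invSelf (Ideal.Quotient.mk (Ideal.span {f}) (X 1))] i) ∧
      φ (AdjoinRoot.of h₂ (AdjoinRoot.root h₁)) = algebraMap (MvPolynomial (Fin 5) k ⧸ Ideal.span {f}) _ (Ideal.Quotient.mk (Ideal.span {f}) (X 3)) ∧
      φ (AdjoinRoot.root h₂) = algebraMap (MvPolynomial (Fin 5) k ⧸ Ideal.span {f}) _ (Ideal.Quotient.mk (Ideal.span {f}) (X 4)) * Away.invSelf (Ideal.Quotient.mk (Ideal.span {f}) (X 1)) := by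
  classical
  let mkA : MvPolynomial (Fin 5) k →+* MvPolynomial (Fin 5) k ⧸ Ideal.span {f} := Ideal.Quotient.mk (Ideal.span {f})
  let L := Localization.Away (mkA (X 1))
  let ι : (MvPolynomial (Fin 5) k ⧸ Ideal.span {f}) →+* L := algebraMap _ _
  let inv : L := Away.invSelf (mkA (X 1))
  have hyi : ι (mkA (X 1)) * inv = 1 := Away.mul_invSelf (S := L) (mkA (X 1))
  let v : Fin 4 → L := ![ι (mkA (X 1)), ι (mkA (X 0)) * inv, ι (mkA (X 2)) * inv, ι (mkA (X 3)) ^ 2 * inv]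
  let g : MvPolynomial (Fin 4) k →+* L := eval₂Hom (ι.comp (mkA.comp MvPolynomial.C)) v
  have hgX : ∀ i, g (X i) = v i := fun i => eval₂Hom_X' _ _ i
  have hF := f_rel_away k f hf
  obtain ⟨φ, hφB, hφt, hφz⟩ : ∃ φ : AdjoinRoot h₂ →+* L, φ.comp (algebraMap (MvPolynomial (Fin 4) k) (AdjoinRoot h₂)) = g ∧
      φ (AdjoinRoot.of h₂ (AdjoinRoot.root h₁)) = ι (mkA (X 3)) ∧ φ (AdjoinRoot.root h₂) = ι (mkA (X 4)) * inv := by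
    refine TauFloorBMonicTower.exists_towerLift (S := L) k h₁ hh₁ (X 1 ^ 2) (1 + X 2 ^ 3) h₂ hh₂ g (ι (mkA (X 3))) (ι (mkA (X 4)) * inv) ?_ ?_
    · rw [hgX, hgX]
      exact TauFloorBXChartIdent.ident_t _ _ _ hyi
    · rw [map_pow, map_add, map_one, map_pow, hgX, hgX, hgX, hgX]
      exact ident_z_y _ _ _ _ _ _ hF hyi
  refine ⟨φ, fun a => ?_, fun i => ?_, hφt, hφz⟩
  · have h := RingHom.congr_fun hφB (C a)
    rw [RingHom.comp_apply] at h
    rw [h]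
    exact eval₂Hom_C _ _ a
  · have h := RingHom.congr_fun hφB (X i)
    rw [RingHom.comp_apply] at h
    rw [h, hgX]

/-- ★ **THE BLOW-DOWN MAP `ψ₁ : A₀ → T₂`** (`x̄, ȳ, ū, t̄, z̄ ↦ yx′, y, yu′, t, yz′`): it kills `f` by `ident_blowdown_y` and the two tower relations. [folklore] -/
theorem exists_blowdownMap (f : MvPolynomial (Fin 5) k) (hf : f = X 4 ^ 2 + X 0 ^ 2 * X 4 + X 1 ^ 3 + X 2 ^ 3 + X 3 ^ 5)
    (h₁ : Polynomial (MvPolynomial (Fin 4) k)) (hh₁ : h₁ = Polynomial.X ^ 2 - Polynomial.C (X 0 * X 3))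
    (h₂ : Polynomial (AdjoinRoot h₁))
    (hh₂ : h₂ = Polynomial.X ^ 2 + (Polynomial.C (algebraMap (MvPolynomial (Fin 4) k) (AdjoinRoot h₁) (X 0 * X 1 ^ 2)) * Polynomial.X +
      Polynomial.C (algebraMap (MvPolynomial (Fin 4) k) (AdjoinRoot h₁) (X 0 * (1 + X 2 ^ 3)) +
        AdjoinRoot.root h₁ * algebraMap (MvPolynomial (Fin 4) k) (AdjoinRoot h₁) (X 3 ^ 2)))) :
    ∃ ψ₁ : (MvPolynomial (Fin 5) k ⧸ Ideal.span {f}) →+* AdjoinRoot h₂,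
      (∀ j : Fin 5, ψ₁ (Ideal.Quotient.mk (Ideal.span {f}) (X j)) =
        ![algebraMap (MvPolynomial (Fin 4) k) (AdjoinRoot h₂) (X 0) * algebraMap (MvPolynomial (Fin 4) k) (AdjoinRoot h₂) (X 1), algebraMap (MvPolynomial (Fin 4) k) (AdjoinRoot h₂) (X 0), algebraMap (MvPolynomial (Fin 4) k) (AdjoinRoot h₂) (X 0) * algebraMap (MvPolynomial (Fin 4) k) (AdjoinRoot h₂) (X 2), AdjoinRoot.of h₂ (AdjoinRoot.root h₁), algebraMap (MvPolynomial (Fin 4) k) (AdjoinRoot h₂) (X 0) * AdjoinRoot.root h₂] j) ∧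
      ∀ a : k, ψ₁ (Ideal.Quotient.mk (Ideal.span {f}) (C a)) = algebraMap (MvPolynomial (Fin 4) k) (AdjoinRoot h₂) (C a) := by
  let aM : MvPolynomial (Fin 4) k →+* AdjoinRoot h₂ := algebraMap (MvPolynomial (Fin 4) k) (AdjoinRoot h₂)
  let u : Fin 5 → AdjoinRoot h₂ := ![algebraMap (MvPolynomial (Fin 4) k) (AdjoinRoot h₂) (X 0) * algebraMap (MvPolynomial (Fin 4) k) (AdjoinRoot h₂) (X 1), algebraMap (MvPolynomial (Fin 4) k) (AdjoinRoot h₂) (X 0), algebraMap (MvPolynomial (Fin 4) k) (AdjoinRoot h₂) (X 0) * algebraMap (MvPolynomial (Fin 4) k) (AdjoinRoot h₂) (X 2), AdjoinRoot.of h₂ (AdjoinRoot.root h₁), algebraMap (MvPolynomial (Fin 4) k) (AdjoinRoot h₂) (X 0) * AdjoinRoot.root h₂]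
  have hz := TauFloorBMonicTower.z_sq_eq k h₁ (X 1 ^ 2) (1 + X 2 ^ 3) h₂ hh₂
  rw [map_pow, map_add, map_one, map_pow] at hz
  have hf0 : eval₂Hom (aM.comp MvPolynomial.C) u f = 0 := by
    rw [hf]
    simp only [map_add, map_mul, map_pow, eval₂Hom_X']
    exact ident_blowdown_y _ _ _ (aM (X 3)) _ _ (t_sq_eq k h₁ hh₁ h₂) hz
  refine ⟨Ideal.Quotient.lift (Ideal.span {f}) (eval₂Hom (aM.comp MvPolynomial.C) u) ?_, fun j => ?_, fun a => ?_⟩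
  · intro a ha
    obtain ⟨c, rfl⟩ := Ideal.mem_span_singleton.mp ha
    rw [map_mul, hf0, zero_mul]
  · rw [Ideal.Quotient.lift_mk]
    exact eval₂Hom_X' _ _ j
  · rw [Ideal.Quotient.lift_mk]
    exact eval₂Hom_C _ _ a

/-! ## §2 The chart map is injective -/

set_option maxHeartbeats 800000 in
-- one `IsLocalization` lift + a generator-by-generator comparison of two ring maps out of the tower
/-- ★ **The chart map `φ : T₂ → A₀[1/ȳ]` is injective**: with `ψ : A₀[1/ȳ] → T₂[1/y]` the extension of the blow-down map, `ψ ∘ φ = (T₂ → T₂[1/y])`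
(checked on `k`, `y, x′, u′, w`, `t`, `z′`), and `T₂ → T₂[1/y]` is injective since `y` is a non-zero-divisor of the FLAT `B₀`-algebra `T₂`. [folklore] -/
theorem chartMap_injective (f : MvPolynomial (Fin 5) k) (hf : f = X 4 ^ 2 + X 0 ^ 2 * X 4 + X 1 ^ 3 + X 2 ^ 3 + X 3 ^ 5)
    (h₁ : Polynomial (MvPolynomial (Fin 4) k)) (hh₁ : h₁ = Polynomial.X ^ 2 - Polynomial.C (X 0 * X 3))
    (h₂ : Polynomial (AdjoinRoot h₁))
    (hh₂ : h₂ = Polynomial.X ^ 2 + (Polynomial.C (algebraMap (MvPolynomial (Fin 4) k) (AdjoinRoot h₁) (X 0 * X 1 ^ 2)) * Polynomial.X +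
      Polynomial.C (algebraMap (MvPolynomial (Fin 4) k) (AdjoinRoot h₁) (X 0 * (1 + X 2 ^ 3)) +
        AdjoinRoot.root h₁ * algebraMap (MvPolynomial (Fin 4) k) (AdjoinRoot h₁) (X 3 ^ 2))))
    (φ : AdjoinRoot h₂ →+* Localization.Away (Ideal.Quotient.mk (Ideal.span {f}) (X 1) : MvPolynomial (Fin 5) k ⧸ Ideal.span {f}))
    (hφC : ∀ a : k, φ (algebraMap (MvPolynomial (Fin 4) k) (AdjoinRoot h₂) (C a)) = algebraMap (MvPolynomial (Fin 5) k ⧸ Ideal.span {f}) _ (Ideal.Quotient.mk (Ideal.span {f}) (C a)))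
    (hφX : ∀ i : Fin 4, φ (algebraMap (MvPolynomial (Fin 4) k) (AdjoinRoot h₂) (X i)) =
        ![algebraMap (MvPolynomial (Fin 5) k ⧸ Ideal.span {f}) _ (Ideal.Quotient.mk (Ideal.span {f}) (X 1)), algebraMap (MvPolynomial (Fin 5) k ⧸ Ideal.span {f}) _ (Ideal.Quotient.mk (Ideal.span {f}) (X 0)) * Away.invSelf (Ideal.Quotient.mk (Ideal.span {f}) (X 1)), algebraMap (MvPolynomial (Fin 5) k ⧸ Ideal.span {f}) _ (Ideal.Quotient.mk (Ideal.span {f}) (X 2)) * Away.invSelf (Ideal.Quotient.mk (Ideal.span {f}) (X 1)),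
          algebraMap (MvPolynomial (Fin 5) k ⧸ Ideal.span {f}) _ (Ideal.Quotient.mk (Ideal.span {f}) (X 3)) ^ 2 * Away.invSelf (Ideal.Quotient.mk (Ideal.span {f}) (X 1))] i)
    (hφt : φ (AdjoinRoot.of h₂ (AdjoinRoot.root h₁)) = algebraMap (MvPolynomial (Fin 5) k ⧸ Ideal.span {f}) _ (Ideal.Quotient.mk (Ideal.span {f}) (X 3)))
    (hφz : φ (AdjoinRoot.root h₂) = algebraMap (MvPolynomial (Fin 5) k ⧸ Ideal.span {f}) _ (Ideal.Quotient.mk (Ideal.span {f}) (X 4)) * Away.invSelf (Ideal.Quotient.mk (Ideal.span {f}) (X 1))) :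
    Function.Injective φ := by
  classical
  let mkA : MvPolynomial (Fin 5) k →+* MvPolynomial (Fin 5) k ⧸ Ideal.span {f} := Ideal.Quotient.mk (Ideal.span {f})
  let L := Localization.Away (mkA (X 1))
  let ι : (MvPolynomial (Fin 5) k ⧸ Ideal.span {f}) →+* L := algebraMap _ _
  let inv : L := Away.invSelf (mkA (X 1))
  let aM : MvPolynomial (Fin 4) k →+* AdjoinRoot h₂ := algebraMap (MvPolynomial (Fin 4) k) (AdjoinRoot h₂)
  let xT : AdjoinRoot h₂ := aM (X 0)
  -- `y = X0` is a non-zero-divisor of `T₂`, so `T₂ → T₂[1/y]` is injective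
  have hx : xT ∈ nonZeroDivisors (AdjoinRoot h₂) := TauFloorBMonicTower.algebraMap_X0_mem_nonZeroDivisors k h₁ hh₁ (X 1 ^ 2) (1 + X 2 ^ 3) h₂ hh₂
  let LT := Localization.Away xT
  let ιT : AdjoinRoot h₂ →+* LT := algebraMap _ _
  have hιT_inj : Function.Injective ιT :=
    IsLocalization.injective LT (M := Submonoid.powers xT) ((Submonoid.powers_le (P := nonZeroDivisors _)).mpr hx)
  -- the blow-down map and its extension `ψ : A₀[1/ȳ] → T₂[1/y]`
  obtain ⟨ψ₁, hψX, hψC⟩ := exists_blowdownMap k f hf h₁ hh₁ h₂ hh₂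
  have hψx : ψ₁ (mkA (X 1)) = xT := hψX 1
  have hunit : IsUnit ((ιT.comp ψ₁) (mkA (X 1))) := by
    rw [RingHom.comp_apply, hψx]
    exact IsLocalization.Away.algebraMap_isUnit xT
  let ψ : L →+* LT := IsLocalization.Away.lift (mkA (X 1)) hunit
  have hψι : ∀ a, ψ (ι a) = ιT (ψ₁ a) := fun a => IsLocalization.Away.lift_eq (mkA (X 1)) hunit a
  have hψi : ψ inv * ιT xT = 1 := by
    have h1 : ψ inv * ψ (ι (mkA (X 1))) = 1 := by
      rw [← map_mul, mul_comm, Away.mul_invSelf, map_one]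
    rwa [hψι, hψx] at h1
  -- generic cancellation: `ιT (x c) · ψ inv = ιT c`
  have hcan : ∀ c : AdjoinRoot h₂, ιT (xT * c) * ψ inv = ιT c := fun c => by
    rw [map_mul, mul_comm (ιT xT), mul_assoc, mul_comm (ιT xT), hψi, mul_one]
  -- `ψ ∘ φ = ιT`
  have hcomp : ψ.comp φ = ιT := by
    refine tower₂_ringHom_ext k h₁ h₂ (MvPolynomial.ringHom_ext (fun a => ?_) (fun i => ?_)) ?_ ?_
    · change ψ (φ (aM (C a))) = ιT (aM (C a))
      rw [hφC, hψι, hψC]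
    · change ψ (φ (aM (X i))) = ιT (aM (X i))
      rw [hφX]
      fin_cases i
      · change ψ (ι (mkA (X 1))) = ιT (aM (X 0))
        rw [hψι, hψx]
      · change ψ (ι (mkA (X 0)) * inv) = ιT (aM (X 1))
        rw [map_mul, hψι, hψX 0]
        exact hcan (aM (X 1))
      · change ψ (ι (mkA (X 2)) * inv) = ιT (aM (X 2))
        rw [map_mul, hψι, hψX 2]
        exact hcan (aM (X 2))
      · change ψ (ι (mkA (X 3)) ^ 2 * inv) = ιT (aM (X 3))
        rw [map_mul, map_pow, hψι, hψX 3]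
        change ιT (AdjoinRoot.of h₂ (AdjoinRoot.root h₁)) ^ 2 * ψ inv = ιT (aM (X 3))
        rw [← map_pow ιT, t_sq_eq k h₁ hh₁ h₂]
        exact hcan (aM (X 3))
    · rw [RingHom.comp_apply, hφt, hψι, hψX 3]; rfl
    · rw [RingHom.comp_apply, hφz, map_mul, hψι, hψX 4]
      exact hcan (AdjoinRoot.root h₂)
  have h2 : Function.Injective (⇑ψ ∘ ⇑φ) := by rw [← RingHom.coe_comp, hcomp]; exact hιT_inj
  exact h2.of_comp

/-! ## §3 ★★ `T₂ ≃ A₀[τ/ȳ]` -/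

set_option maxHeartbeats 1600000 in
-- generator bookkeeping on both sides (as in `TauFloorBXChartIdent.exists_chartEquiv`)
/-- ★★ **The tower `T₂(X1², 1+X2³)` is the Rees chart `D(ȳ)` of `Bl_τ X`**: a ring isomorphism `e : T₂ ≃+* blowupAlgebra τ ȳ` with
`y, x′, u′, w, t, z′ ↦ ȳ, x̄/ȳ, ū/ȳ, t̄²/ȳ, t̄, z̄/ȳ` (values in `A₀[1/ȳ]`). [cite: GortzWedhorn2020, (13.19) p. 415] -/
theorem exists_chartEquiv (f : MvPolynomial (Fin 5) k) (hf : f = X 4 ^ 2 + X 0 ^ 2 * X 4 + X 1 ^ 3 + X 2 ^ 3 + X 3 ^ 5)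
    (h₁ : Polynomial (MvPolynomial (Fin 4) k)) (hh₁ : h₁ = Polynomial.X ^ 2 - Polynomial.C (X 0 * X 3))
    (h₂ : Polynomial (AdjoinRoot h₁))
    (hh₂ : h₂ = Polynomial.X ^ 2 + (Polynomial.C (algebraMap (MvPolynomial (Fin 4) k) (AdjoinRoot h₁) (X 0 * X 1 ^ 2)) * Polynomial.X +
      Polynomial.C (algebraMap (MvPolynomial (Fin 4) k) (AdjoinRoot h₁) (X 0 * (1 + X 2 ^ 3)) +
        AdjoinRoot.root h₁ * algebraMap (MvPolynomial (Fin 4) k) (AdjoinRoot h₁) (X 3 ^ 2)))) :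
    ∃ e : AdjoinRoot h₂ ≃+* blowupAlgebra (Ideal.span {Ideal.Quotient.mk (Ideal.span {f}) (X 0), Ideal.Quotient.mk (Ideal.span {f}) (X 1), Ideal.Quotient.mk (Ideal.span {f}) (X 2), Ideal.Quotient.mk (Ideal.span {f}) (X 3) ^ 2, Ideal.Quotient.mk (Ideal.span {f}) (X 4)} : Ideal (MvPolynomial (Fin 5) k ⧸ Ideal.span {f})) (Ideal.Quotient.mk (Ideal.span {f}) (X 1)),
      (∀ a : k, ((e (algebraMap (MvPolynomial (Fin 4) k) (AdjoinRoot h₂) (C a)) : blowupAlgebra _ (Ideal.Quotient.mk (Ideal.span {f}) (X 1))) : Localization.Away (Ideal.Quotient.mk (Ideal.span {f}) (X 1) : MvPolynomial (Fin 5) k ⧸ Ideal.span {f})) = algebraMap (MvPolynomial (Fin 5) k ⧸ Ideal.span {f}) _ (Ideal.Quotient.mk (Ideal.span {f}) (C a))) ∧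
      (∀ i : Fin 4, ((e (algebraMap (MvPolynomial (Fin 4) k) (AdjoinRoot h₂) (X i)) : blowupAlgebra _ (Ideal.Quotient.mk (Ideal.span {f}) (X 1))) : Localization.Away (Ideal.Quotient.mk (Ideal.span {f}) (X 1) : MvPolynomial (Fin 5) k ⧸ Ideal.span {f})) =
        ![algebraMap (MvPolynomial (Fin 5) k ⧸ Ideal.span {f}) _ (Ideal.Quotient.mk (Ideal.span {f}) (X 1)), algebraMap (MvPolynomial (Fin 5) k ⧸ Ideal.span {f}) _ (Ideal.Quotient.mk (Ideal.span {f}) (X 0)) * Away.invSelf (Ideal.Quotient.mk (Ideal.span {f}) (X 1)), algebraMap (MvPolynomial (Fin 5) k ⧸ Ideal.span {f}) _ (Ideal.Quotient.mk (Ideal.span {f}) (X 2)) * Away.invSelf (Ideal.Quotient.mk (Ideal.span {f}) (X 1)),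
          algebraMap (MvPolynomial (Fin 5) k ⧸ Ideal.span {f}) _ (Ideal.Quotient.mk (Ideal.span {f}) (X 3)) ^ 2 * Away.invSelf (Ideal.Quotient.mk (Ideal.span {f}) (X 1))] i) ∧
      ((e (AdjoinRoot.of h₂ (AdjoinRoot.root h₁)) : blowupAlgebra _ (Ideal.Quotient.mk (Ideal.span {f}) (X 1))) : Localization.Away (Ideal.Quotient.mk (Ideal.span {f}) (X 1) : MvPolynomial (Fin 5) k ⧸ Ideal.span {f})) = algebraMap (MvPolynomial (Fin 5) k ⧸ Ideal.span {f}) _ (Ideal.Quotient.mk (Ideal.span {f}) (X 3)) ∧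
      ((e (AdjoinRoot.root h₂) : blowupAlgebra _ (Ideal.Quotient.mk (Ideal.span {f}) (X 1))) : Localization.Away (Ideal.Quotient.mk (Ideal.span {f}) (X 1) : MvPolynomial (Fin 5) k ⧸ Ideal.span {f})) = algebraMap (MvPolynomial (Fin 5) k ⧸ Ideal.span {f}) _ (Ideal.Quotient.mk (Ideal.span {f}) (X 4)) * Away.invSelf (Ideal.Quotient.mk (Ideal.span {f}) (X 1)) := by
  classical
  obtain ⟨φ, hφC, hφX, hφt, hφz⟩ := exists_chartMap k f hf h₁ hh₁ h₂ hh₂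
  have hinj := chartMap_injective k f hf h₁ hh₁ h₂ hh₂ φ hφC hφX hφt hφz
  obtain ⟨ψ₁, hψX, hψC⟩ := exists_blowdownMap k f hf h₁ hh₁ h₂ hh₂
  -- abbreviations (terms only)
  let mkA : MvPolynomial (Fin 5) k →+* MvPolynomial (Fin 5) k ⧸ Ideal.span {f} := Ideal.Quotient.mk (Ideal.span {f})
  let τ : Ideal (MvPolynomial (Fin 5) k ⧸ Ideal.span {f}) := Ideal.span {mkA (X 0), mkA (X 1), mkA (X 2), mkA (X 3) ^ 2, mkA (X 4)}
  let L := Localization.Away (mkA (X 1))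
  let B : Subalgebra (MvPolynomial (Fin 5) k ⧸ Ideal.span {f}) L := blowupAlgebra τ (mkA (X 1))
  let ι : (MvPolynomial (Fin 5) k ⧸ Ideal.span {f}) →+* L := algebraMap _ _
  let inv : L := Away.invSelf (mkA (X 1))
  let aM : MvPolynomial (Fin 4) k →+* AdjoinRoot h₂ := algebraMap (MvPolynomial (Fin 4) k) (AdjoinRoot h₂)
  have hxi : ι (mkA (X 1)) * inv = 1 := Away.mul_invSelf (S := L) (mkA (X 1))
  -- (1) `φ ∘ ψ₁ = ι`
  have hφψ : φ.comp ψ₁ = ι := by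
    refine Ideal.Quotient.ringHom_ext (MvPolynomial.ringHom_ext (fun a => ?_) (fun j => ?_))
    · change φ (ψ₁ (mkA (C a))) = ι (mkA (C a))
      rw [hψC, hφC]
    · change φ (ψ₁ (mkA (X j))) = ι (mkA (X j))
      rw [hψX]
      fin_cases j
      · change φ (aM (X 0) * aM (X 1)) = ι (mkA (X 0))
        rw [map_mul, hφX 0, hφX 1]
        change ι (mkA (X 1)) * (ι (mkA (X 0)) * inv) = ι (mkA (X 0))
        rw [mul_comm, mul_assoc, mul_comm inv, hxi, mul_one]
      · exact hφX 0
      · change φ (aM (X 0) * aM (X 2)) = ι (mkA (X 2))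
        rw [map_mul, hφX 0, hφX 2]
        change ι (mkA (X 1)) * (ι (mkA (X 2)) * inv) = ι (mkA (X 2))
        rw [mul_comm, mul_assoc, mul_comm inv, hxi, mul_one]
      · exact hφt
      · change φ (aM (X 0) * AdjoinRoot.root h₂) = ι (mkA (X 4))
        rw [map_mul, hφX 0, hφz]
        change ι (mkA (X 1)) * (ι (mkA (X 4)) * inv) = ι (mkA (X 4))
        rw [mul_comm, mul_assoc, mul_comm inv, hxi, mul_one]
  have hι_mem : ∀ a, ι a ∈ φ.range := fun a => ⟨ψ₁ a, by rw [← RingHom.comp_apply, hφψ]⟩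
  -- (2) `range φ ⊆ B`: every generator of the tower lands in `B`
  have hB₀ : ∀ b : MvPolynomial (Fin 4) k, φ (aM b) ∈ B := by
    intro b
    induction b using MvPolynomial.induction_on with
    | C a => rw [hφC]; exact B.algebraMap_mem _
    | add p q hp hq => rw [map_add, map_add]; exact B.add_mem hp hq
    | mul_X p i hp =>
      rw [map_mul, map_mul]
      refine B.mul_mem hp ?_
      rw [hφX]
      fin_cases i
      · exact B.algebraMap_mem (mkA (X 1))
      · change ι (mkA (X 0)) * inv ∈ B
        exact div_mem_blowupAlgebra τ (mkA (X 1)) (Ideal.subset_span (by simp))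
      · change ι (mkA (X 2)) * inv ∈ B
        exact div_mem_blowupAlgebra τ (mkA (X 1)) (Ideal.subset_span (by simp))
      · change ι (mkA (X 3)) ^ 2 * inv ∈ B
        rw [← map_pow ι]
        exact div_mem_blowupAlgebra τ (mkA (X 1)) (Ideal.subset_span (by simp))
  have hrange_le : ∀ c, φ c ∈ B := by
    -- level 1, level 2 via `adjoinRoot_subring_eq_top`
    have l1 : ∀ x : AdjoinRoot h₁, (φ.comp (AdjoinRoot.of h₂)) x ∈ B := by
      refine TauFloorF5YChartIdent.adjoinRoot_subring_eq_top h₁ (B.toSubring.comap (φ.comp (AdjoinRoot.of h₂))) (fun b => ?_) ?_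
      · change φ (AdjoinRoot.of h₂ (AdjoinRoot.of h₁ b)) ∈ B
        rw [← algebraMap_tower_apply]; exact hB₀ b
      · change φ (AdjoinRoot.of h₂ (AdjoinRoot.root h₁)) ∈ B
        rw [hφt]; exact B.algebraMap_mem _
    refine TauFloorF5YChartIdent.adjoinRoot_subring_eq_top h₂ (B.toSubring.comap φ) (fun b => l1 b) ?_
    change φ (AdjoinRoot.root h₂) ∈ B
    rw [hφz]
    change ι (mkA (X 4)) * inv ∈ B
    exact div_mem_blowupAlgebra τ (mkA (X 1)) (Ideal.subset_span (by simp))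
  -- (3) `B ⊆ range φ`: the range is an `A₀`-subalgebra containing the generators `g/x̄`, `g ∈ τ`
  let Rφ : Subalgebra (MvPolynomial (Fin 5) k ⧸ Ideal.span {f}) L :=
    { carrier := φ.range
      mul_mem' := fun ha hb => φ.range.mul_mem ha hb
      one_mem' := φ.range.one_mem
      add_mem' := fun ha hb => φ.range.add_mem ha hb
      zero_mem' := φ.range.zero_mem
      algebraMap_mem' := fun a => hι_mem a }
  have hgens : blowupAlgebraGens τ (mkA (X 1)) ⊆ (Rφ : Set L) := by
    rintro _ ⟨g, hg, rfl⟩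
    change ι g * inv ∈ φ.range
    refine Submodule.span_induction (p := fun g _ => ι g * inv ∈ φ.range) ?_ ?_ ?_ ?_ hg
    · intro g hg
      simp only [Set.mem_insert_iff, Set.mem_singleton_iff] at hg
      rcases hg with rfl | rfl | rfl | rfl | rfl
      · exact ⟨aM (X 1), hφX 1⟩
      · exact ⟨1, by rw [map_one, hxi]⟩
      · exact ⟨aM (X 2), hφX 2⟩
      · exact ⟨aM (X 3), by rw [hφX 3, map_pow ι]; rfl⟩
      · exact ⟨AdjoinRoot.root h₂, hφz⟩
    · rw [map_zero, zero_mul]; exact φ.range.zero_mem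
    · intro a b _ _ ha hb
      rw [map_add, add_mul]; exact φ.range.add_mem ha hb
    · intro r a _ ha
      rw [smul_eq_mul, map_mul, mul_assoc]; exact φ.range.mul_mem (hι_mem r) ha
  have hle_range : B ≤ Rφ := Algebra.adjoin_le hgens
  -- (4) the equivalence
  have hsurj : Function.Surjective (φ.codRestrict B.toSubring fun c => hrange_le c) := by
    intro b
    obtain ⟨c, hc⟩ := (hle_range b.2 : (b : L) ∈ φ.range)
    exact ⟨c, Subtype.ext hc⟩
  have hinj' : Function.Injective (φ.codRestrict B.toSubring fun c => hrange_le c) := fun a b h =>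
    hinj (congrArg Subtype.val h)
  exact ⟨RingEquiv.ofBijective (φ.codRestrict B.toSubring fun c => hrange_le c) ⟨hinj', hsurj⟩, hφC, hφX, hφt, hφz⟩

end Summit.ResolutionOfSingularities.ResolutionOfSingularities.Theorems.FInjectiveMacaulayfication.TauFloorBYChartIdent

end
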